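import Literature.MathematicalPhysics.PowerSystems.LuriePostnikovSlabDecayRate
import HarnessLib

/-!
# A CERTIFIED Euclidean inner ball of the slab certificate's well (the «inner-ball reading» made a theorem)

Topic `Literature/MathematicalPhysics/PowerSystems`, namespace
`Literature.MathematicalPhysics.PowerSystems.LyapunovFunctionFamily`; the `SlabCertificate` class of
`LuriePostnikovSlabCertificate.lean` and its upper comparison matrix `upperMatrix = P + Cᵀ·diag(λ_k b_k)·C`
of `LuriePostnikovSlabDecayRate.lean`, BY NAME. Everything is PROVED (no named fact, no definition).

WHAT IS PROVED. The producers report beside every slab/Popov row an «inner ball» `|x|² ≤ c/t_W` with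
`t_W·1 − (P + Cᵀ·diag(λb)·C) ⪰ 0` (toolchain B's `inner_ball` block) — so far a VALIDATED reading. Here it
becomes a theorem about the certified well `{x ∈ slab γ : V x ≤ c}`:

* (plumbing) Cauchy–Schwarz per channel: `(Cx)_k² ≤ (C_kᵀC_k)·|x|²`;
* `SlabCertificate.mem_well_of_dotProduct_le` — if `t·1 − upperMatrix ⪰ 0`, the sector hypothesis `hsec`
  holds on the window `γ > 0`, `(C_kᵀC_k)·|x|² < γ_k²` for every channel and `t·|x|² ≤ c`, then `x` lies
  in the open slab AND `V x ≤ c`;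
* `SlabCertificate.ball_subset_well` — hence for a radius² `ϱ` with `t·ϱ ≤ c` and `(C_kᵀC_k)·ϱ < γ_k²`
  (two families of closed rational inequalities an instance decides), the Euclidean ball `{|x|² ≤ ϱ}` is
  contained in the certified well: every motion of the MODEL starting with `|x(0)|² ≤ ϱ` is covered by the
  row's region theorem (`well_subset_regionOfAttraction`) — a CERTIFIED inner ball, the honest companion
  of the VALIDATED «r = √(c/t_W)» readings.

THREE COLUMNS. CERTIFIED: the inclusion `{|x|² ≤ ϱ} ⊆ {x ∈ slab γ : V ≤ c}` for the MODEL
`ẋ = Ax − BF(Cx)` of the instance (inner estimate of an inner estimate; sufficient, not sharp).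
VALIDATED: the producer's float radius. MODELLED: as the parent row. Nothing here says a grid is stable.
[cite: Khalil2002, Theorem 4.10 (hypothesis (4.25), upper half); Pai1981, §2.16 Theorem [18] eq. (2.63); VuTuritsyn2017, §4.3 Theorem 1 (set ℛ)]
-/

noncomputable section

open Real Set Filter Matrix Finset
open scoped Topology

namespace Literature.MathematicalPhysics.PowerSystems.LyapunovFunctionFamily

variable {ι κ : Type*} [Fintype ι] [Fintype κ] [DecidableEq ι] [DecidableEq κ]

omit [Fintype κ] [DecidableEq ι] [DecidableEq κ] in
/-- Cauchy–Schwarz per channel (plumbing): `((Cx)_k)² ≤ (C_k ⬝ C_k)·(x ⬝ x)`. [folklore] -/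
private theorem channel_sq_le_dotProduct (C : Matrix κ ι ℝ) (x : ι → ℝ) (k : κ) :
    (C *ᵥ x) k ^ 2 ≤ (C k ⬝ᵥ C k) * (x ⬝ᵥ x) := by
  have h := Finset.sum_mul_sq_le_sq_mul_sq (Finset.univ : Finset ι) (fun i => C k i) (fun i => x i)
  simp only [Matrix.mulVec, dotProduct, pow_two] at h ⊢
  simpa [pow_two] using h

namespace SlabCertificate

variable {S : System ι κ} (Λ : SlabCertificate S)

/-- **A point of a small Euclidean ball lies in the certified well.** If `t·1 − upperMatrix ⪰ 0`, the
sector hypothesis holds on the window `γ` (`γ_k > 0`), `(C_kᵀC_k)·|x|² < γ_k²` on every channel and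
`t·|x|² ≤ c`,
then `x ∈ slab γ` and `V x ≤ c` (`|(Cx)_k| < γ_k` by Cauchy–Schwarz, then `V x ≤ t|x|² ≤ c` by
`V_le_mul_of_slab`). [cite: Khalil2002, Theorem 4.10 (hypothesis (4.25)); VuTuritsyn2017, §4.3 Theorem 1 (set ℛ)] -/
theorem mem_well_of_dotProduct_le {γ : κ → ℝ} {t c : ℝ} (hγ : ∀ k, 0 < γ k)
    (hup : (t • (1 : Matrix ι ι ℝ) - Λ.upperMatrix).PosSemidef)
    (hsec : ∀ k ξ, |ξ - S.δs k| ≤ γ k → Λ.a k ≤ Real.cos ξ ∧ Real.cos ξ ≤ Λ.b k)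
    {x : ι → ℝ} (hslab : ∀ k, (S.C k ⬝ᵥ S.C k) * (x ⬝ᵥ x) < γ k ^ 2) (hlev : t * (x ⬝ᵥ x) ≤ c) :
    x ∈ S.slab γ ∧ Λ.V x ≤ c := by
  have hmem : ∀ k, |(S.C *ᵥ x) k| < γ k := by
    intro k
    have h1 := channel_sq_le_dotProduct S.C x k
    have h2 : (S.C *ᵥ x) k ^ 2 < γ k ^ 2 := h1.trans_lt (hslab k)
    exact abs_lt_of_sq_lt_sq h2 (hγ k).le
  refine ⟨hmem, ?_⟩
  have hV := Λ.V_le_mul_of_slab hup hsec (fun k => (hmem k).le)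
  exact hV.trans hlev

/-- **THE CERTIFIED INNER BALL**: for a radius² `ϱ` with `t·ϱ ≤ c` and `(C_kᵀC_k)·ϱ < γ_k²` on every
channel (with `t·1 − upperMatrix ⪰ 0`, `t ≥ 0`, and `hsec` on the window `γ`), the Euclidean ball
`{x : xᵀx ≤ ϱ}` is contained in the certified well `{x ∈ slab γ : V x ≤ c}` — so the row's region theorem
(`well_subset_regionOfAttraction`) covers every motion of the model with `|x(0)|² ≤ ϱ`.
[cite: Khalil2002, Theorem 4.10 (hypothesis (4.25)); VuTuritsyn2017, §4.3 Theorem 1 (set ℛ); Pai1981, §2.16 Theorem [18]] -/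
theorem ball_subset_well {γ : κ → ℝ} {t c ϱ : ℝ} (hγ : ∀ k, 0 < γ k) (ht : 0 ≤ t)
    (hup : (t • (1 : Matrix ι ι ℝ) - Λ.upperMatrix).PosSemidef)
    (hsec : ∀ k ξ, |ξ - S.δs k| ≤ γ k → Λ.a k ≤ Real.cos ξ ∧ Real.cos ξ ≤ Λ.b k)
    (hϱc : t * ϱ ≤ c) (hϱγ : ∀ k, (S.C k ⬝ᵥ S.C k) * ϱ < γ k ^ 2) :
    {x : ι → ℝ | x ⬝ᵥ x ≤ ϱ} ⊆ {x | x ∈ S.slab γ ∧ Λ.V x ≤ c} := by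
  intro x hx
  have hxx : x ⬝ᵥ x ≤ ϱ := hx
  refine Λ.mem_well_of_dotProduct_le hγ hup hsec (fun k => ?_)
    ((mul_le_mul_of_nonneg_left hxx ht).trans hϱc)
  have hC : 0 ≤ S.C k ⬝ᵥ S.C k := Finset.sum_nonneg fun i _ => mul_self_nonneg (S.C k i)
  exact (mul_le_mul_of_nonneg_left hxx hC).trans_lt (hϱγ k)

end SlabCertificate

end Literature.MathematicalPhysics.PowerSystems.LyapunovFunctionFamily

end
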